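import Mathlib.NumberTheory.Padics.PadicIntegers
import Mathlib.Algebra.MvPolynomial.PDeriv
import Mathlib.Analysis.Normed.Group.Ultra
import Mathlib.Topology.MetricSpace.Ultra.Pi
import Mathlib.Topology.MetricSpace.Contracting
import Mathlib.LinearAlgebra.Matrix.Adjugate
import Mathlib.LinearAlgebra.Matrix.ToLinearEquiv
import HarnessLib

/-!
# Hensel's lemma for square polynomial systems over `ℤ_p`: the exact image of a small ball

Topic `Literature/RingTheory/HenselLemma` (theorems only; no definitions, no named facts). For a
system `F = (F₁, …, Fₙ)` of polynomials in `n` variables with coefficients in `ℤ_p`, a point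
`x₀ ∈ ℤ_pⁿ` with Jacobian matrix `J = (∂Fᵢ/∂xⱼ(x₀))` of nonzero determinant `d`, and a radius
`0 < r ≤ |d|_p / p` (i.e. `r < |d|_p`), the polynomial map `F` restricted to the ball `x₀ + B_r`,
`B_r = {h : ‖h‖ ≤ r}` (sup norm), is a bijection onto the "linearised" ball `F(x₀) + J·B_r`:

* `exists_eq_add_mulVec_of_norm_le` — `F(x₀ + B_r) ⊆ F(x₀) + J·B_r`;
* `existsUnique_eval_add_eq` — every point of `F(x₀) + J·B_r` has exactly one preimage in
  `x₀ + B_r`;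
* `image_eval_closedBall_eq`, `injOn_eval_closedBall` — the set-theoretic summary
  `F(x₀ + B_r) = F(x₀) + J·B_r`, `F` injective on `x₀ + B_r`.

This is the quantitative non-archimedean inverse function theorem behind `p`-adic changes of
variables (the image of a small ball under an étale polynomial map is the translate of a lattice
of volume `|det J|_p · vol(B_r)`; Igusa, *An introduction to the theory of local zeta functions*,
§7.4; Serre, *Lie algebras and Lie groups*, Part II, Ch. III "Analytic manifolds", inverse function
theorem), in the explicit form used for polynomial maps with `ℤ_p`-coefficients: no convergence
questions arise, and the constants are `r ≤ |d|/p` with contraction factor `r/|d|`.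

## Proof

Taylor's formula to first order with an integral quadratic remainder, proved by induction on the
polynomial (`rem_C`, `rem_add`, `rem_mul_X`): `P(x + h) = P(x) + Σⱼ ∂ⱼP(x) hⱼ + R_P(x, h)` with
`‖R_P(x,h)‖ ≤ ‖h‖²` and `‖R_P(x,h) − R_P(x,h')‖ ≤ max(‖h‖,‖h'‖) ‖h − h'‖` for `x, h, h' ∈ ℤ_pⁿ`
(`norm_rem_le`, `norm_rem_sub_rem_le`). Linear algebra over `ℤ_p` (`exists_mulVec_eq_of_norm_le`):
if `‖y‖ ≤ |d| r` then `J z = y` has a solution with `‖z‖ ≤ r` (`z = adj(J) y / d`). Hence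
`F(x₀ + h) − F(x₀) = J(h + w)` with `‖w‖ ≤ r` (inclusion), and for the surjectivity the map
`h ↦ z − J⁻¹R(h)` is a contraction of the complete ball `B_r` with constant `r/|d| < 1`, whose fixed
points are exactly the solutions of `F(x₀ + h) = F(x₀) + J z` (Banach's fixed point theorem,
Mathlib `ContractingWith`).

## References

* J.-I. Igusa, *An introduction to the theory of local zeta functions*, AMS/IP Studies in Adv.
  Math. 14 (2000), §7.4 (p-adic change of variables / implicit function theorem). [folklore]
* J.-P. Serre, *Lie algebras and Lie groups*, LNM 1500, Part II, Ch. III (inverse function theorem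
  over complete valued fields). [folklore]
* For the use: M. Bhargava, A. Shankar, Ann. of Math. (2) 181 (2015) 191–242, §3.4 (the `p`-adic
  change-of-measure formula). [cite: BhargavaShankarAnnals2015, §3.4 (published numbering; arXiv:1006.1002v2 §2.4 Prop. 2.8 "principle of permanence of identities")]
-/

noncomputable section

open MvPolynomial Matrix Metric
open scoped NNReal

namespace Literature.RingTheory.HenselLemma

/-! ## §1 Taylor's formula to first order: the algebra of the remainder -/

section Algebra

variable {R : Type*} [CommRing R] {ι : Type*} [Fintype ι]

/-- The remainder of a constant vanishes. [folklore] -/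
theorem rem_C (a : R) (x h : ι → R) :
    eval (x + h) (C a : MvPolynomial ι R) - eval x (C a) - ∑ j, eval x (pderiv j (C a)) * h j = 0 := by
  simp

/-- The remainder is additive in the polynomial. [folklore] -/
theorem rem_add (P Q : MvPolynomial ι R) (x h : ι → R) :
    eval (x + h) (P + Q) - eval x (P + Q) - ∑ j, eval x (pderiv j (P + Q)) * h j =
      (eval (x + h) P - eval x P - ∑ j, eval x (pderiv j P) * h j) +
        (eval (x + h) Q - eval x Q - ∑ j, eval x (pderiv j Q) * h j) := by
  simp only [map_add, add_mul, Finset.sum_add_distrib]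
  ring

/-- The remainder of `P · Xₖ`: `R_{P Xₖ}(x,h) = hₖ Σᵢ ∂ᵢP(x) hᵢ + (xₖ + hₖ) R_P(x,h)`. [folklore] -/
theorem rem_mul_X (P : MvPolynomial ι R) (k : ι) (x h : ι → R) :
    eval (x + h) (P * X k) - eval x (P * X k) - ∑ j, eval x (pderiv j (P * X k)) * h j =
      h k * (∑ i, eval x (pderiv i P) * h i) +
        (x k + h k) * (eval (x + h) P - eval x P - ∑ j, eval x (pderiv j P) * h j) := by
  classical
  have hder : ∀ j, eval x (pderiv j (P * X k)) * h j =
      eval x (pderiv j P) * h j * x k + (if j = k then eval x P * h k else 0) := by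
    intro j
    rw [pderiv_mul, map_add, map_mul, map_mul, eval_X]
    by_cases hjk : j = k
    · subst hjk; rw [pderiv_X_self, map_one, if_pos rfl]; ring
    · rw [pderiv_X_of_ne (Ne.symm hjk), map_zero, if_neg hjk]; ring
  simp only [hder, Finset.sum_add_distrib, Finset.sum_ite_eq', Finset.mem_univ, if_true, map_mul,
    eval_X, Pi.add_apply]
  rw [← Finset.sum_mul]
  ring

end Algebra

/-! ## §2 Norm estimates for the remainder over `ℤ_p` -/

section Norms

variable {p : ℕ} [Fact p.Prime] {ι : Type*} [Fintype ι]

/-- `‖Σᵢ aᵢ hᵢ‖ ≤ ‖h‖` for `aᵢ ∈ ℤ_p` (ultrametric inequality, `‖aᵢ‖ ≤ 1`). [folklore] -/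
theorem norm_sum_mul_le (a h : ι → ℤ_[p]) : ‖∑ i, a i * h i‖ ≤ ‖h‖ := by
  refine IsUltrametricDist.norm_sum_le_of_forall_le_of_nonneg (norm_nonneg h) fun i _ ↦ ?_
  rw [norm_mul]
  exact (mul_le_of_le_one_left (norm_nonneg _) (PadicInt.norm_le_one _)).trans
    (norm_le_pi_norm h i)

/-- **The remainder is quadratic**: `‖P(x+h) − P(x) − Σⱼ ∂ⱼP(x)hⱼ‖ ≤ ‖h‖²` for `P` with
`ℤ_p`-coefficients and `x, h ∈ ℤ_pⁿ`. [folklore] -/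
theorem norm_rem_le (P : MvPolynomial ι ℤ_[p]) (x h : ι → ℤ_[p]) :
    ‖eval (x + h) P - eval x P - ∑ j, eval x (pderiv j P) * h j‖ ≤ ‖h‖ ^ 2 := by
  induction P using MvPolynomial.induction_on with
  | C a => rw [rem_C]; simp
  | add P Q hP hQ =>
      rw [rem_add]
      exact (IsUltrametricDist.norm_add_le_max _ _).trans (max_le hP hQ)
  | mul_X P k hP =>
      rw [rem_mul_X]
      refine (IsUltrametricDist.norm_add_le_max _ _).trans (max_le ?_ ?_)
      · rw [norm_mul, sq]
        exact mul_le_mul (norm_le_pi_norm h k) (norm_sum_mul_le _ h) (norm_nonneg _) (norm_nonneg _)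
      · rw [norm_mul]
        exact (mul_le_of_le_one_left (norm_nonneg _) (PadicInt.norm_le_one _)).trans hP

/-- **The remainder is Lipschitz with small constant**:
`‖R_P(x,h) − R_P(x,h')‖ ≤ max(‖h‖, ‖h'‖) · ‖h − h'‖`. [folklore] -/
theorem norm_rem_sub_rem_le (P : MvPolynomial ι ℤ_[p]) (x h h' : ι → ℤ_[p]) :
    ‖(eval (x + h) P - eval x P - ∑ j, eval x (pderiv j P) * h j) -
        (eval (x + h') P - eval x P - ∑ j, eval x (pderiv j P) * h' j)‖ ≤
      max ‖h‖ ‖h'‖ * ‖h - h'‖ := by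
  have hM0 : 0 ≤ max ‖h‖ ‖h'‖ := le_max_of_le_left (norm_nonneg _)
  induction P using MvPolynomial.induction_on with
  | C a => rw [rem_C, rem_C, sub_zero, norm_zero]; positivity
  | add P Q hP hQ =>
      rw [rem_add, rem_add, add_sub_add_comm]
      exact (IsUltrametricDist.norm_add_le_max _ _).trans (max_le hP hQ)
  | mul_X P k hP =>
      rw [rem_mul_X, rem_mul_X]
      set S : (ι → ℤ_[p]) → ℤ_[p] := fun v ↦ ∑ i, eval x (pderiv i P) * v i with hS
      set RP : (ι → ℤ_[p]) → ℤ_[p] := fun v ↦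
        eval (x + v) P - eval x P - ∑ j, eval x (pderiv j P) * v j with hRP
      have hSlin : S h - S h' = S (h - h') := by
        simp only [hS, ← Finset.sum_sub_distrib, Pi.sub_apply, mul_sub]
      have e : h k * S h + (x k + h k) * RP h - (h' k * S h' + (x k + h' k) * RP h') =
          (h k - h' k) * S h + h' k * (S h - S h') + ((x k + h k) * (RP h - RP h') +
            (h k - h' k) * RP h') := by ring
      change ‖h k * S h + (x k + h k) * RP h - (h' k * S h' + (x k + h' k) * RP h')‖ ≤ _
      rw [e]
      have hk : ‖h k - h' k‖ ≤ ‖h - h'‖ := norm_le_pi_norm (h - h') k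
      refine (IsUltrametricDist.norm_add_le_max _ _).trans (max_le ?_ ?_)
      · refine (IsUltrametricDist.norm_add_le_max _ _).trans (max_le ?_ ?_)
        · rw [norm_mul, mul_comm]
          exact mul_le_mul ((norm_sum_mul_le _ h).trans (le_max_left _ _)) hk (norm_nonneg _) hM0
        · rw [norm_mul, hSlin]
          exact mul_le_mul ((norm_le_pi_norm h' k).trans (le_max_right _ _)) (norm_sum_mul_le _ _)
            (norm_nonneg _) hM0
      · refine (IsUltrametricDist.norm_add_le_max _ _).trans (max_le ?_ ?_)
        · rw [norm_mul]
          exact (mul_le_of_le_one_left (norm_nonneg _) (PadicInt.norm_le_one _)).trans hP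
        · rw [norm_mul, mul_comm]
          refine mul_le_mul ?_ hk (norm_nonneg _) hM0
          calc ‖RP h'‖ ≤ ‖h'‖ ^ 2 := norm_rem_le P x h'
            _ ≤ ‖h'‖ := by
                rw [sq]; exact mul_le_of_le_one_left (norm_nonneg _) (pi_norm_le_iff_of_nonneg
                  zero_le_one |>.mpr fun i ↦ PadicInt.norm_le_one _)
            _ ≤ max ‖h‖ ‖h'‖ := le_max_right _ _

end Norms

/-! ## §3 Systems: the Jacobian matrix and the vector remainder -/

section Systems

variable {p : ℕ} [Fact p.Prime] {ι : Type*} [Fintype ι]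

/-- **Taylor's formula for a system**: `F(x + h) = F(x) + J(x) h + R(x, h)` where
`J(x)ᵢⱼ = ∂ⱼFᵢ(x)` and `R` is the vector of remainders. [folklore] -/
theorem eval_add_eq (F : ι → MvPolynomial ι ℤ_[p]) (x h : ι → ℤ_[p]) :
    (fun i ↦ eval (x + h) (F i)) = (fun i ↦ eval x (F i)) +
      (Matrix.of fun i j ↦ eval x (pderiv j (F i))) *ᵥ h +
        fun i ↦ eval (x + h) (F i) - eval x (F i) - ∑ j, eval x (pderiv j (F i)) * h j := by
  funext i
  simp only [Pi.add_apply, mulVec, dotProduct, of_apply]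
  ring

/-- The vector remainder is quadratic: `‖R(x,h)‖ ≤ ‖h‖²` (sup norms). [folklore] -/
theorem norm_remVec_le (F : ι → MvPolynomial ι ℤ_[p]) (x h : ι → ℤ_[p]) :
    ‖fun i ↦ eval (x + h) (F i) - eval x (F i) - ∑ j, eval x (pderiv j (F i)) * h j‖ ≤ ‖h‖ ^ 2 :=
  (pi_norm_le_iff_of_nonneg (by positivity)).mpr fun i ↦ norm_rem_le (F i) x h

/-- The vector remainder is Lipschitz: `‖R(x,h) − R(x,h')‖ ≤ max(‖h‖,‖h'‖) ‖h − h'‖`. [folklore] -/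
theorem norm_remVec_sub_le (F : ι → MvPolynomial ι ℤ_[p]) (x h h' : ι → ℤ_[p]) :
    ‖(fun i ↦ eval (x + h) (F i) - eval x (F i) - ∑ j, eval x (pderiv j (F i)) * h j) -
        fun i ↦ eval (x + h') (F i) - eval x (F i) - ∑ j, eval x (pderiv j (F i)) * h' j‖ ≤
      max ‖h‖ ‖h'‖ * ‖h - h'‖ :=
  (pi_norm_le_iff_of_nonneg (mul_nonneg (le_max_of_le_left (norm_nonneg _)) (norm_nonneg _))).mpr
    fun i ↦ by simpa only [Pi.sub_apply] using norm_rem_sub_rem_le (F i) x h h'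

/-! ## §4 Linear algebra over `ℤ_p`: solving `J z = y` with a norm bound -/

/-- `‖A v‖ ≤ ‖v‖` for a matrix with entries in `ℤ_p`. [folklore] -/
theorem norm_mulVec_le (A : Matrix ι ι ℤ_[p]) (v : ι → ℤ_[p]) : ‖A *ᵥ v‖ ≤ ‖v‖ :=
  (pi_norm_le_iff_of_nonneg (norm_nonneg v)).mpr fun i ↦ norm_sum_mul_le (fun j ↦ A i j) v

/-- `‖d‖ · ‖v‖ ≤ ‖d • v‖` (in fact equality) for `d ∈ ℤ_p`, `v ∈ ℤ_pⁿ` with the sup norm. [folklore] -/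
theorem norm_mul_norm_le_norm_smul (d : ℤ_[p]) (v : ι → ℤ_[p]) : ‖d‖ * ‖v‖ ≤ ‖d • v‖ := by
  rcases eq_or_ne d 0 with rfl | hd
  · simp
  have hdpos : 0 < ‖d‖ := norm_pos_iff.mpr hd
  rw [mul_comm, ← le_div_iff₀ hdpos]
  refine (pi_norm_le_iff_of_nonneg (div_nonneg (norm_nonneg _) hdpos.le)).mpr fun i ↦ ?_
  rw [le_div_iff₀ hdpos, mul_comm, ← norm_mul]
  exact norm_le_pi_norm (d • v) i

variable [DecidableEq ι]

/-- `J` is injective on `ℤ_pⁿ` when `det J ≠ 0` (`adj(J) J = det J · 1`). [folklore] -/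
theorem eq_zero_of_mulVec_eq_zero {J : Matrix ι ι ℤ_[p]} (hd : J.det ≠ 0) {v : ι → ℤ_[p]}
    (hv : J *ᵥ v = 0) : v = 0 := by
  have h : J.det • v = 0 := by
    rw [← one_mulVec v, ← smul_mulVec, ← adjugate_mul, ← mulVec_mulVec, hv, mulVec_zero]
  exact (smul_eq_zero.mp h).resolve_left hd

/-- **Solving `J z = y` in a small ball.** If `det J = d ≠ 0`, `0 ≤ r ≤ 1` and `‖y‖ ≤ |d| · r`, then
there is `z ∈ ℤ_pⁿ` with `J z = y` and `‖z‖ ≤ r` (namely `z = adj(J) y / d`). [folklore] -/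
theorem exists_mulVec_eq_of_norm_le (J : Matrix ι ι ℤ_[p]) (hd : J.det ≠ 0) {r : ℝ} (hr : 0 ≤ r)
    (hr1 : r ≤ 1) {y : ι → ℤ_[p]} (hy : ‖y‖ ≤ ‖J.det‖ * r) :
    ∃ z : ι → ℤ_[p], J *ᵥ z = y ∧ ‖z‖ ≤ r := by
  set w := J.adjugate *ᵥ y with hw
  have hwn : ‖w‖ ≤ ‖J.det‖ * r := (norm_mulVec_le _ _).trans hy
  have hdpos : 0 < ‖J.det‖ := norm_pos_iff.mpr hd
  -- each coordinate of `w` is divisible by `d`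
  have hdiv : ∀ i, ∃ zi : ℤ_[p], w i = J.det * zi ∧ ‖zi‖ ≤ r := by
    intro i
    have hwi : ‖w i‖ ≤ ‖J.det‖ * r := (norm_le_pi_norm w i).trans hwn
    -- in the discrete valuation ring `ℤ_p`, `‖b‖ ≤ ‖a‖` with `a ≠ 0` forces `a ∣ b`
    -- (cf. `Literature.NumberTheory.EllipticCurves.PadicOneUnits.dvd_of_norm_le`)
    have hdvd : ∀ {a b : ℤ_[p]}, a ≠ 0 → ‖b‖ ≤ ‖a‖ → a ∣ b := by
      intro a b ha hab
      rw [PadicInt.norm_eq_zpow_neg_valuation ha, PadicInt.norm_le_pow_iff_mem_span_pow,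
        Ideal.mem_span_singleton] at hab
      rw [PadicInt.unitCoeff_spec ha]
      exact (Units.isUnit _).mul_left_dvd.mpr hab
    obtain ⟨zi, hzi⟩ := hdvd hd (hwi.trans (mul_le_of_le_one_right hdpos.le hr1))
    refine ⟨zi, hzi, le_of_mul_le_mul_left ?_ hdpos⟩
    rw [← norm_mul, ← hzi]; exact hwi
  choose z hz hzr using hdiv
  refine ⟨z, ?_, (pi_norm_le_iff_of_nonneg hr).mpr hzr⟩
  have hwz : w = J.det • z := funext fun i ↦ by rw [Pi.smul_apply, smul_eq_mul]; exact hz i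
  have h1 : J *ᵥ w = J.det • y := by
    rw [hw, mulVec_mulVec, mul_adjugate, smul_mulVec, one_mulVec]
  rw [hwz, mulVec_smul] at h1
  exact smul_right_injective (ι → ℤ_[p]) hd h1

/-! ## §5 Hensel's lemma for the system: the image of a small ball -/

/-- **Inclusion `F(x₀ + B_r) ⊆ F(x₀) + J·B_r`.** Let `J = (∂ⱼFᵢ(x₀))` have determinant `d ≠ 0`
and `0 ≤ r ≤ |d|_p`. Then for every `h` with `‖h‖ ≤ r` there is `z` with `‖z‖ ≤ r` and
`F(x₀ + h) = F(x₀) + J z`. [folklore] -/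
theorem exists_eq_add_mulVec_of_norm_le (F : ι → MvPolynomial ι ℤ_[p]) (x₀ : ι → ℤ_[p])
    (hd : (Matrix.of fun i j ↦ eval x₀ (pderiv j (F i))).det ≠ 0) {r : ℝ} (hr : 0 ≤ r)
    (hrd : r ≤ ‖(Matrix.of fun i j ↦ eval x₀ (pderiv j (F i))).det‖) {h : ι → ℤ_[p]}
    (hh : ‖h‖ ≤ r) :
    ∃ z : ι → ℤ_[p], ‖z‖ ≤ r ∧ (fun i ↦ eval (x₀ + h) (F i)) =
      (fun i ↦ eval x₀ (F i)) + (Matrix.of fun i j ↦ eval x₀ (pderiv j (F i))) *ᵥ z := by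
  set J := Matrix.of fun i j ↦ eval x₀ (pderiv j (F i)) with hJ
  have hr1 : r ≤ 1 := hrd.trans (PadicInt.norm_le_one _)
  have hRn : ‖fun i ↦ eval (x₀ + h) (F i) - eval x₀ (F i) - ∑ j, eval x₀ (pderiv j (F i)) * h j‖ ≤
      ‖J.det‖ * r := by
    calc _ ≤ ‖h‖ ^ 2 := norm_remVec_le F x₀ h
      _ ≤ r * r := by rw [sq]; exact mul_le_mul hh hh (norm_nonneg _) hr
      _ ≤ ‖J.det‖ * r := mul_le_mul_of_nonneg_right hrd hr
  obtain ⟨w, hw, hwr⟩ := exists_mulVec_eq_of_norm_le J hd hr hr1 hRn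
  refine ⟨h + w, (IsUltrametricDist.norm_add_le_max _ _).trans (max_le hh hwr), ?_⟩
  rw [eval_add_eq F x₀ h, ← hJ, ← hw, mulVec_add, add_assoc]

/-- **Bijectivity onto `F(x₀) + J·B_r`.** Let `J = (∂ⱼFᵢ(x₀))` have determinant `d ≠ 0` and
`0 ≤ r < |d|_p`. Then for every `z` with `‖z‖ ≤ r` there is exactly one `h` with `‖h‖ ≤ r` and
`F(x₀ + h) = F(x₀) + J z` (the map `h ↦ z − J⁻¹R(h)` is a contraction of the complete ball `B_r`
with constant `r/|d|_p`). [folklore] -/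
theorem existsUnique_eval_add_eq (F : ι → MvPolynomial ι ℤ_[p]) (x₀ : ι → ℤ_[p])
    (hd : (Matrix.of fun i j ↦ eval x₀ (pderiv j (F i))).det ≠ 0) {r : ℝ} (hr : 0 ≤ r)
    (hrd : r < ‖(Matrix.of fun i j ↦ eval x₀ (pderiv j (F i))).det‖) {z : ι → ℤ_[p]}
    (hz : ‖z‖ ≤ r) :
    ∃! h : ι → ℤ_[p], ‖h‖ ≤ r ∧ (fun i ↦ eval (x₀ + h) (F i)) =
      (fun i ↦ eval x₀ (F i)) + (Matrix.of fun i j ↦ eval x₀ (pderiv j (F i))) *ᵥ z := by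
  set J := Matrix.of fun i j ↦ eval x₀ (pderiv j (F i)) with hJ
  set R : (ι → ℤ_[p]) → (ι → ℤ_[p]) := fun h i ↦
    eval (x₀ + h) (F i) - eval x₀ (F i) - ∑ j, eval x₀ (pderiv j (F i)) * h j with hR
  have hdpos : 0 < ‖J.det‖ := norm_pos_iff.mpr hd
  have hr1 : r ≤ 1 := hrd.le.trans (PadicInt.norm_le_one _)
  -- Taylor
  have taylor : ∀ h, (fun i ↦ eval (x₀ + h) (F i)) = (fun i ↦ eval x₀ (F i)) + J *ᵥ h + R h :=
    fun h ↦ eval_add_eq F x₀ h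
  -- the correction `w(h)` with `J w(h) = R(h)`, `‖w(h)‖ ≤ r`, for `‖h‖ ≤ r`
  have hsol : ∀ h : closedBall (0 : ι → ℤ_[p]) r, ∃ w : ι → ℤ_[p], J *ᵥ w = R h.1 ∧ ‖w‖ ≤ r := by
    intro h
    have hh : ‖(h : ι → ℤ_[p])‖ ≤ r := mem_closedBall_zero_iff.mp h.2
    refine exists_mulVec_eq_of_norm_le J hd hr hr1 ?_
    calc ‖R h.1‖ ≤ ‖(h : ι → ℤ_[p])‖ ^ 2 := norm_remVec_le F x₀ h
      _ ≤ r * r := by rw [sq]; exact mul_le_mul hh hh (norm_nonneg _) hr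
      _ ≤ ‖J.det‖ * r := mul_le_mul_of_nonneg_right hrd.le hr
  choose w hw hwr using hsol
  -- the contraction `Φ(h) = z − w(h)` of the complete ball `B_r`
  have hΦmem : ∀ h : closedBall (0 : ι → ℤ_[p]) r, z - w h ∈ closedBall (0 : ι → ℤ_[p]) r := by
    intro h
    rw [mem_closedBall_zero_iff, sub_eq_add_neg]
    exact (IsUltrametricDist.norm_add_le_max _ _).trans (max_le hz (by rw [norm_neg]; exact hwr h))
  let Φ : closedBall (0 : ι → ℤ_[p]) r → closedBall (0 : ι → ℤ_[p]) r := fun h ↦ ⟨z - w h, hΦmem h⟩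
  have hΦval : ∀ h, ((Φ h : closedBall (0 : ι → ℤ_[p]) r) : ι → ℤ_[p]) = z - w h := fun h ↦ rfl
  -- Lipschitz estimate: `|d| ‖w h − w h'‖ ≤ ‖R h − R h'‖ ≤ r ‖h − h'‖`
  have hlip : ∀ h h' : closedBall (0 : ι → ℤ_[p]) r,
      ‖w h - w h'‖ ≤ r / ‖J.det‖ * ‖(h : ι → ℤ_[p]) - h'‖ := by
    intro h h'
    have hh : ‖(h : ι → ℤ_[p])‖ ≤ r := mem_closedBall_zero_iff.mp h.2
    have hh' : ‖(h' : ι → ℤ_[p])‖ ≤ r := mem_closedBall_zero_iff.mp h'.2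
    have e1 : J.det • (w h - w h') = J.adjugate *ᵥ (R h.1 - R h'.1) := by
      rw [← hw h, ← hw h', ← mulVec_sub, mulVec_mulVec, adjugate_mul, smul_mulVec, one_mulVec]
    have e2 : ‖J.det‖ * ‖w h - w h'‖ ≤ r * ‖(h : ι → ℤ_[p]) - h'‖ := by
      calc ‖J.det‖ * ‖w h - w h'‖ ≤ ‖J.det • (w h - w h')‖ := norm_mul_norm_le_norm_smul _ _
        _ = ‖J.adjugate *ᵥ (R h.1 - R h'.1)‖ := by rw [e1]
        _ ≤ ‖R h.1 - R h'.1‖ := norm_mulVec_le _ _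
        _ ≤ max ‖(h : ι → ℤ_[p])‖ ‖(h' : ι → ℤ_[p])‖ * ‖(h : ι → ℤ_[p]) - h'‖ :=
            norm_remVec_sub_le F x₀ h h'
        _ ≤ r * ‖(h : ι → ℤ_[p]) - h'‖ :=
            mul_le_mul_of_nonneg_right (max_le hh hh') (norm_nonneg _)
    rw [div_mul_eq_mul_div, le_div_iff₀ hdpos, mul_comm]
    exact e2
  let K : ℝ≥0 := ⟨r / ‖J.det‖, div_nonneg hr hdpos.le⟩
  have hKcoe : (K : ℝ) = r / ‖J.det‖ := rfl
  have hK : K < 1 := by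
    rw [← NNReal.coe_lt_coe, NNReal.coe_one, hKcoe, div_lt_one hdpos]
    exact hrd
  have hcontr : ContractingWith K Φ := by
    refine ⟨hK, LipschitzWith.of_dist_le_mul fun h h' ↦ ?_⟩
    rw [Subtype.dist_eq, hΦval, hΦval, dist_eq_norm, Subtype.dist_eq, dist_eq_norm, hKcoe,
      show z - w h - (z - w h') = -(w h - w h') by abel, norm_neg]
    exact hlip h h'
  haveI : CompleteSpace (closedBall (0 : ι → ℤ_[p]) r) := isClosed_closedBall.completeSpace_coe
  haveI : Nonempty (closedBall (0 : ι → ℤ_[p]) r) := ⟨⟨0, mem_closedBall_self hr⟩⟩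
  -- fixed points of `Φ` are exactly the solutions
  have sol_iff : ∀ h : closedBall (0 : ι → ℤ_[p]) r,
      Function.IsFixedPt Φ h ↔ (fun i ↦ eval (x₀ + (h : ι → ℤ_[p])) (F i)) =
        (fun i ↦ eval x₀ (F i)) + J *ᵥ z := by
    intro h
    rw [Function.IsFixedPt, Subtype.ext_iff, hΦval, taylor (h : ι → ℤ_[p])]
    constructor
    · intro hfix
      -- `h = z - w h`
      have e' : J *ᵥ (z - w h) = J *ᵥ z - R h.1 := by rw [mulVec_sub, hw h]
      rw [hfix] at e'
      have : J *ᵥ (h : ι → ℤ_[p]) + R h.1 = J *ᵥ z := by rw [e', sub_add_cancel]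
      rw [add_assoc, this]
    · intro hsolv
      have h1 : J *ᵥ (h : ι → ℤ_[p]) + R h.1 = J *ᵥ z := add_left_cancel (by rw [← add_assoc]; exact hsolv)
      have h2 : J *ᵥ (z - w h - h) = 0 := by
        rw [mulVec_sub, mulVec_sub, hw h, ← h1]; abel
      have h3 := eq_zero_of_mulVec_eq_zero hd h2
      rw [sub_eq_zero] at h3
      exact h3
  refine ⟨(ContractingWith.fixedPoint Φ hcontr : closedBall (0 : ι → ℤ_[p]) r), ⟨?_, ?_⟩, ?_⟩
  · exact mem_closedBall_zero_iff.mp (ContractingWith.fixedPoint Φ hcontr).2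
  · exact (sol_iff _).mp (hcontr.fixedPoint_isFixedPt)
  · rintro h ⟨hh, hsolv⟩
    have hfix : Function.IsFixedPt Φ ⟨h, mem_closedBall_zero_iff.mpr hh⟩ := (sol_iff _).mpr hsolv
    have := hcontr.fixedPoint_unique hfix
    exact congrArg Subtype.val this

/-- **The image of a small ball** (`0 ≤ r < |det J|_p`): `F(x₀ + B_r) = F(x₀) + J · B_r`, where
`x₀ + B_r = closedBall x₀ r`, `B_r = closedBall 0 r` for the sup norm on `ℤ_pⁿ`. [folklore] -/
theorem image_eval_closedBall_eq (F : ι → MvPolynomial ι ℤ_[p]) (x₀ : ι → ℤ_[p])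
    (hd : (Matrix.of fun i j ↦ eval x₀ (pderiv j (F i))).det ≠ 0) {r : ℝ} (hr : 0 ≤ r)
    (hrd : r < ‖(Matrix.of fun i j ↦ eval x₀ (pderiv j (F i))).det‖) :
    (fun x : ι → ℤ_[p] ↦ fun i ↦ eval x (F i)) '' closedBall x₀ r =
      (fun z ↦ (fun i ↦ eval x₀ (F i)) + (Matrix.of fun i j ↦ eval x₀ (pderiv j (F i))) *ᵥ z) ''
        closedBall 0 r := by
  ext y
  simp only [Set.mem_image, mem_closedBall, dist_eq_norm, sub_zero]
  constructor
  · rintro ⟨x, hx, rfl⟩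
    obtain ⟨z, hz, hzx⟩ := exists_eq_add_mulVec_of_norm_le F x₀ hd hr hrd.le hx
    exact ⟨z, hz, by rw [← hzx, add_sub_cancel]⟩
  · rintro ⟨z, hz, rfl⟩
    obtain ⟨h, ⟨hh, hsolv⟩, -⟩ := existsUnique_eval_add_eq F x₀ hd hr hrd hz
    exact ⟨x₀ + h, by rwa [add_sub_cancel_left], hsolv⟩

/-- **Injectivity on a small ball** (`0 ≤ r < |det J|_p`): `F` is injective on `closedBall x₀ r`.
[folklore] -/
theorem injOn_eval_closedBall (F : ι → MvPolynomial ι ℤ_[p]) (x₀ : ι → ℤ_[p])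
    (hd : (Matrix.of fun i j ↦ eval x₀ (pderiv j (F i))).det ≠ 0) {r : ℝ} (hr : 0 ≤ r)
    (hrd : r < ‖(Matrix.of fun i j ↦ eval x₀ (pderiv j (F i))).det‖) :
    Set.InjOn (fun x : ι → ℤ_[p] ↦ fun i ↦ eval x (F i)) (closedBall x₀ r) := by
  intro x hx x' hx' hxx'
  rw [mem_closedBall, dist_eq_norm] at hx hx'
  obtain ⟨z, hz, hzx⟩ := exists_eq_add_mulVec_of_norm_le F x₀ hd hr hrd.le hx
  obtain ⟨h, -, huniq⟩ := existsUnique_eval_add_eq F x₀ hd hr hrd hz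
  have e1 : x - x₀ = h := huniq (x - x₀) ⟨hx, by rw [← hzx]⟩
  have e2 : x' - x₀ = h := by
    refine huniq (x' - x₀) ⟨hx', ?_⟩
    rw [← hzx, add_sub_cancel, add_sub_cancel]
    exact hxx'.symm
  exact sub_left_injective (e1.trans e2.symm)

end Systems

end Literature.RingTheory.HenselLemma

end
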